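import Mathlib
import HarnessLib

/-!
# King 1986 Prop. 3.7: per-SLICE pointwise bounds of the multiscale telescoping (2.17) sum to the
# sub-unit power-law profile — the bookkeeping implication «(3.63)-shape per slice ⇒ |∇G_k(x,y)| ≤ C′|x−y|^{1−d}»

**Citation header (reproduction of the BOOKKEEPING step around PUBLISHED statements; literature seat
`b2b-balaban-t4-lit2` gen 5 of the Bałaban lattice Yang–Mills cell `pub-balaban`; record `t4/T4-LIT2-CITABLE-NE.md`
v2.8 §8.11 (a); GAPS A-t4lit2g5-1).  v1.0.1: DOCSTRING-ONLY wording fix of one header bullet after the cross-read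
(pv11-g15, GAPS C-pv11g15-1: ok CONSISTENT, DOCFIX owed 0, INFO I-1); every declaration byte-identical to v1 (p187289).**
C. King, *The U(1) Higgs model. I. The continuum limit*, Commun. Math. Phys. **102** (1986) 649–677 [King1986].
Page images read (as images) by this seat: `b2b-balaban-template/king-renders/1986-cmp102-king-u1-higgs-I-p005-x2.png`
(p. 653: (2.13), (2.17)), `…-p008-x2.png` (p. 656: Thm 3.3 (3.6)–(3.8)),
`t4/b2b-balaban-t4-lit2/g5/renders/1986-cmp102-king-u1-higgs-I-p015-x2.png` (p. 663: (3.60), (3.62), Prop. 3.7).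

**What King prints (verbatim).**  p. 653: «The operator (2.13) can be decomposed into a sum of contributions from
scales between Ω and Ω^{(k)}: G^ε_k(Ω, A) = C^{(0),ε}(Ω, A) + Σ_{j=1}^{k−1} a_j²(L^jε)^{−4}G^ε_j(Ω, A)Q_j(A)*·
C^{(j),L^jε}(Ω, A)Q_j(A)G^ε_j(Ω, A) ≡ Σ_{j=0}^{k−1} G^ε_{(j)}(Ω, A), (2.17)»; p. 663: «**Proposition 3.7.** For x, y,
z ∈ T_η, 0 < α < 1, and all 0 ≤ j ≤ k − 1, |G^η_{(j)}(x, y)|, |∂^η_μG^η_{(j)}(x, y)| ≤ C{(L^jη)^{2−d}, (L^jη)^{1−d}}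
· exp[−δ₀(L^jη)^{−1}|x − y|], (3.63) … Proposition 3.7 follows immediately from Theorem 3.3 and the scaling
properties of the operators.» (Thm 3.3 «is proved in [Ba 4]» = Bałaban, CMP 89 (1983) 571–597.)  Objects: King's scalar
block propagator (2.13) with REGULAR ABELIAN background A (Def. 3.2), the A = 0 vector operators; d = 2, 3 as printed
(the exponents are written in d); fine lattice T_η of spacing η = L^{−k}, unit k-blocks.

**What is proved here (everything PROVED from Mathlib; NO named fact; nothing about Bałaban's papers; [folklore]).**
The elementary summation that turns a per-slice bound of the printed shape (3.63) into a power-law profile, uniformly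
in the number of slices `k` and in the spacing `η`:
* `sliceSum_le`: for `L ≥ 2`, `0 < η ≤ r`, `δ > 0`, `p ≥ 1`,
  `Σ_{j<k} exp(−δ·r/(ηL^j)) / (ηL^j)^p ≤ (2·(p+1)!/δ^{p+1} + 2) / r^p`
  (split the slices at `ηL^j ≈ r`: the coarser ones give a geometric series with ratio `L^{−p} ≤ 1/2`
  (`sum_geom_decr_le_two`), the finer ones `t^p e^{−δt} ≤ (p+1)!/(δ^{p+1}t)` along `t = r/(ηL^j) ≥ 1`, geometric with
  ratio `1/L ≤ 1/2` (`sum_geom_incr_le_two`); `Real.pow_div_factorial_le_exp` is the exponential tail);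
* `abs_sum_slices_le`: if slice kernels `g j x y` obey `|g j x y| ≤ C·exp(−δ·ρ(x,y)/(ηL^j))/(ηL^j)^p` for `j < k`, then
  `|Σ_{j<k} g j x y| ≤ C·(2·(p+1)!/δ^{p+1} + 2)/ρ(x,y)^p` whenever `ρ(x,y) ≥ η` — with `p = d − 1` this is the reading
  «(3.63) for the gradient slices, ALL 0 ≤ j ≤ k − 1 (the j = 0 slice G_(0) = C^{(0)} of (2.17) included) ⇒
  |∂G_k(x,y)| ≤ C′|x − y|^{1−d} for η ≤ |x − y|» of the record's §8.11 (a) (v2.8.2; the partial sum over 1 ≤ j ≤ k − 1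
  bounds the difference ∂G_k − ∂C^{(0)} by the same constant — take `g 0 := 0`; cross-read pv11-g15 INFO I-1),
  i.e. the profile (W1) of the T⁴ cell's `T4TwoSpacingDefect.ConsistencySized` (t4-ne3-p1-g5, clause (T2)) for King's
  objects; for Bałaban's covariant B9 propagators NOTHING is asserted — the lemma only makes «per-slice single-scale
  decay at every intermediate scale + telescoping ⇒ (W1)» an implication by name.
Rung (B)+1 literature service; NOT an estimate of any NE; NOT summit progress.
-/

noncomputable section

open Finset Real

namespace Literature.MathematicalPhysics.QuantumFieldTheory.King1986

/-- A finite family of terms of an INCREASING geometric progression `c·q^j` (`q ≥ 2`), each at most `1`, sums to at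
most `2` (the largest term dominates). [folklore] -/
theorem sum_geom_incr_le_two {S : Finset ℕ} {c q : ℝ} (hc : 0 ≤ c) (hq : 2 ≤ q)
    (h1 : ∀ j ∈ S, c * q ^ j ≤ 1) : ∑ j ∈ S, c * q ^ j ≤ 2 := by
  rcases S.eq_empty_or_nonempty with rfl | hne
  · simp
  set J := S.max' hne with hJ
  have hq0 : 0 ≤ q := by linarith
  have hsub : S ⊆ Finset.range (J + 1) := fun j hj =>
    Finset.mem_range.2 (Nat.lt_succ_of_le (S.le_max' j hj))
  have hgeom : (∑ j ∈ Finset.range (J + 1), q ^ j) * (q - 1) = q ^ (J + 1) - 1 := geom_sum_mul q (J + 1)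
  have hpow : q ^ (J + 1) = q ^ J * q := pow_succ q J
  have hqJ : 0 ≤ q ^ J := pow_nonneg hq0 J
  have hS2 : ∑ j ∈ Finset.range (J + 1), q ^ j ≤ 2 * q ^ J := by
    nlinarith [hgeom, hpow, hqJ, mul_nonneg hqJ (by linarith : (0:ℝ) ≤ q - 2),
      Finset.sum_nonneg (fun j (_ : j ∈ Finset.range (J + 1)) => pow_nonneg hq0 j)]
  calc ∑ j ∈ S, c * q ^ j ≤ ∑ j ∈ Finset.range (J + 1), c * q ^ j :=
        Finset.sum_le_sum_of_subset_of_nonneg hsub (fun j _ _ => by positivity)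
    _ = c * ∑ j ∈ Finset.range (J + 1), q ^ j := by rw [Finset.mul_sum]
    _ ≤ c * (2 * q ^ J) := by gcongr
    _ = 2 * (c * q ^ J) := by ring
    _ ≤ 2 * 1 := by gcongr; exact h1 J (S.max'_mem hne)
    _ = 2 := by norm_num

/-- A finite family of terms of a DECREASING geometric progression `C·ρ^j` (`0 ≤ ρ ≤ 1/2`), each at most `1`, sums to
at most `2`. [folklore] -/
theorem sum_geom_decr_le_two {S : Finset ℕ} {C ρ : ℝ} (hC : 0 ≤ C) (hρ0 : 0 ≤ ρ) (hρ : ρ ≤ 1 / 2)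
    (h1 : ∀ j ∈ S, C * ρ ^ j ≤ 1) : ∑ j ∈ S, C * ρ ^ j ≤ 2 := by
  rcases S.eq_empty_or_nonempty with rfl | hne
  · simp
  set J := S.min' hne with hJ
  set N := S.max' hne + 1 with hN
  have hsub : S ⊆ Finset.Ico J N := fun j hj =>
    Finset.mem_Ico.2 ⟨S.min'_le j hj, Nat.lt_succ_of_le (S.le_max' j hj)⟩
  have hρ1 : ρ < 1 := by linarith
  have hIco : ∑ j ∈ Finset.Ico J N, ρ ^ j ≤ ρ ^ J / (1 - ρ) := geom_sum_Ico_le_of_lt_one hρ0 hρ1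
  have hden : ρ ^ J / (1 - ρ) ≤ 2 * ρ ^ J := by
    rw [div_le_iff₀ (by linarith)]
    nlinarith [pow_nonneg hρ0 J]
  calc ∑ j ∈ S, C * ρ ^ j ≤ ∑ j ∈ Finset.Ico J N, C * ρ ^ j :=
        Finset.sum_le_sum_of_subset_of_nonneg hsub (fun j _ _ => by positivity)
    _ = C * ∑ j ∈ Finset.Ico J N, ρ ^ j := by rw [Finset.mul_sum]
    _ ≤ C * (2 * ρ ^ J) := by gcongr; exact hIco.trans hden
    _ = 2 * (C * ρ ^ J) := by ring
    _ ≤ 2 * 1 := by gcongr; exact h1 J (S.min'_mem hne)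
    _ = 2 := by norm_num

/-- The exponential tail in the form used for the fine slices: `t^p·e^{−δt} ≤ (p+1)!/(δ^{p+1}·t)` for `t > 0`.
[folklore] -/
theorem pow_mul_exp_neg_le {δ t : ℝ} (hδ : 0 < δ) (ht : 0 < t) (p : ℕ) :
    t ^ p * Real.exp (-(δ * t)) ≤ (p + 1).factorial / (δ ^ (p + 1) * t) := by
  have h := Real.pow_div_factorial_le_exp (δ * t) (by positivity) (p + 1)
  have hfac : (0 : ℝ) < (p + 1).factorial := by exact_mod_cast Nat.factorial_pos _
  have hdt : 0 < (δ * t) ^ (p + 1) := by positivity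
  rw [div_le_iff₀ hfac] at h
  rw [Real.exp_neg, le_div_iff₀ (by positivity)]
  have hexp : 0 < Real.exp (δ * t) := Real.exp_pos _
  -- t^p * (exp)⁻¹ * (δ^(p+1) * t) = (δ t)^(p+1) / exp ≤ (p+1)!
  have key : t ^ p * (Real.exp (δ * t))⁻¹ * (δ ^ (p + 1) * t) = (δ * t) ^ (p + 1) / Real.exp (δ * t) := by
    rw [mul_pow, div_eq_mul_inv]; ring
  rw [key, div_le_iff₀ hexp]
  linarith

/-- **The slice sum.**  For `L ≥ 2`, `0 < η ≤ r`, `δ > 0`, `p ≥ 1` and any number of slices `k`: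
`Σ_{j<k} exp(−δ·r/(ηL^j))/(ηL^j)^p ≤ (2·(p+1)!/δ^{p+1} + 2)/r^p` — uniform in `k` and `η`. [folklore] -/
theorem sliceSum_le (L η δ r : ℝ) (p k : ℕ) (hL : 2 ≤ L) (hη : 0 < η) (hδ : 0 < δ) (hr : η ≤ r)
    (hp : 1 ≤ p) :
    ∑ j ∈ Finset.range k, Real.exp (-(δ * (r / (η * L ^ j)))) / (η * L ^ j) ^ p
      ≤ (2 * (p + 1).factorial / δ ^ (p + 1) + 2) / r ^ p := by
  have hr0 : 0 < r := lt_of_lt_of_le hη hr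
  have hL0 : 0 < L := by linarith
  set A : ℝ := (p + 1).factorial / δ ^ (p + 1) with hA
  have hA0 : 0 ≤ A := by positivity
  -- the slice variable t_j = r/(ηL^j) and the termwise majorant
  set t : ℕ → ℝ := fun j => r / (η * L ^ j) with ht
  have htpos : ∀ j, 0 < t j := fun j => by positivity
  set b : ℕ → ℝ := fun j => if 1 ≤ t j then A * (t j)⁻¹ else (t j) ^ p with hb
  have hterm : ∀ j, Real.exp (-(δ * (r / (η * L ^ j)))) / (η * L ^ j) ^ p ≤ b j / r ^ p := by
    intro j
    have hs : 0 < η * L ^ j := by positivity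
    have hsr : η * L ^ j = r / t j := by
      rw [ht]; field_simp
    by_cases h1 : 1 ≤ t j
    · -- fine slice: exponential tail
      have hb1 : b j = A * (t j)⁻¹ := by simp [hb, h1]
      rw [hb1]
      have htail := pow_mul_exp_neg_le hδ (htpos j) p
      -- exp(-δ t)/s^p = t^p exp(-δ t)/r^p
      have hrew : Real.exp (-(δ * (r / (η * L ^ j)))) / (η * L ^ j) ^ p
          = (t j) ^ p * Real.exp (-(δ * t j)) / r ^ p := by
        have : r / (η * L ^ j) = t j := rfl
        rw [this, hsr, div_pow]
        field_simp
      rw [hrew]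
      have : (t j) ^ p * Real.exp (-(δ * t j)) ≤ A * (t j)⁻¹ := by
        calc (t j) ^ p * Real.exp (-(δ * t j)) ≤ (p + 1).factorial / (δ ^ (p + 1) * t j) := htail
          _ = A * (t j)⁻¹ := by rw [hA]; field_simp
      exact div_le_div_of_nonneg_right this (by positivity)
    · -- coarse slice: drop the exponential
      have hb2 : b j = (t j) ^ p := by simp [hb, h1]
      rw [hb2]
      have hexp : Real.exp (-(δ * (r / (η * L ^ j)))) ≤ 1 := by
        rw [Real.exp_le_one_iff]
        have : 0 ≤ δ * (r / (η * L ^ j)) := by positivity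
        linarith
      calc Real.exp (-(δ * (r / (η * L ^ j)))) / (η * L ^ j) ^ p ≤ 1 / (η * L ^ j) ^ p :=
            div_le_div_of_nonneg_right hexp (by positivity)
        _ = (t j) ^ p / r ^ p := by
            rw [hsr, div_pow]; field_simp
  -- sum the majorants
  have hsum : ∑ j ∈ Finset.range k, Real.exp (-(δ * (r / (η * L ^ j)))) / (η * L ^ j) ^ p
      ≤ (∑ j ∈ Finset.range k, b j) / r ^ p := by
    rw [Finset.sum_div]
    exact Finset.sum_le_sum fun j _ => hterm j
  refine hsum.trans ?_
  apply div_le_div_of_nonneg_right _ (by positivity)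
  -- split the index set at t_j = 1
  rw [hb, Finset.sum_ite]
  have hfine : ∑ j ∈ (Finset.range k).filter (fun j => 1 ≤ t j), A * (t j)⁻¹ ≤ A * 2 := by
    rw [← Finset.mul_sum]
    gcongr
    -- (t j)⁻¹ = (η/r)·L^j, increasing geometric, ≤ 1 on the fine slices
    have hrepr : ∀ j, (t j)⁻¹ = (η / r) * L ^ j := by
      intro j; rw [ht]; field_simp
    calc ∑ j ∈ (Finset.range k).filter (fun j => 1 ≤ t j), (t j)⁻¹
        = ∑ j ∈ (Finset.range k).filter (fun j => 1 ≤ t j), (η / r) * L ^ j :=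
          Finset.sum_congr rfl fun j _ => hrepr j
      _ ≤ 2 := by
          apply sum_geom_incr_le_two (by positivity) hL
          intro j hj
          rw [Finset.mem_filter] at hj
          rw [← hrepr j]
          exact inv_le_one_of_one_le₀ hj.2
  have hcoarse : ∑ j ∈ (Finset.range k).filter (fun j => ¬ 1 ≤ t j), (t j) ^ p ≤ 2 := by
    -- (t j)^p = (r/η)^p · ((L^p)⁻¹)^j, decreasing geometric with ratio ≤ 1/2, < 1 on the coarse slices
    have hrepr : ∀ j, (t j) ^ p = (r / η) ^ p * ((L ^ p)⁻¹) ^ j := by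
      intro j
      show (r / (η * L ^ j)) ^ p = (r / η) ^ p * ((L ^ p)⁻¹) ^ j
      have hLj : (L ^ j) ^ p = (L ^ p) ^ j := by rw [← pow_mul, ← pow_mul, mul_comm]
      rw [div_pow, div_pow, mul_pow, hLj, inv_pow]
      field_simp
    have hρ : (L ^ p)⁻¹ ≤ 1 / 2 := by
      rw [inv_eq_one_div]
      apply div_le_div_of_nonneg_left zero_le_one (by norm_num)
      calc (2 : ℝ) ≤ L := hL
        _ = L ^ 1 := (pow_one L).symm
        _ ≤ L ^ p := pow_le_pow_right₀ (by linarith) hp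
    calc ∑ j ∈ (Finset.range k).filter (fun j => ¬ 1 ≤ t j), (t j) ^ p
        = ∑ j ∈ (Finset.range k).filter (fun j => ¬ 1 ≤ t j), (r / η) ^ p * ((L ^ p)⁻¹) ^ j :=
          Finset.sum_congr rfl fun j _ => hrepr j
      _ ≤ 2 := by
          apply sum_geom_decr_le_two (by positivity) (by positivity) hρ
          intro j hj
          rw [Finset.mem_filter, not_le] at hj
          rw [← hrepr j]
          exact pow_le_one₀ (htpos j).le hj.2.le
  calc ∑ j ∈ (Finset.range k).filter (fun j => 1 ≤ t j), A * (t j)⁻¹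
        + ∑ j ∈ (Finset.range k).filter (fun j => ¬ 1 ≤ t j), (t j) ^ p ≤ A * 2 + 2 := add_le_add hfine hcoarse
    _ = 2 * ((p + 1).factorial : ℝ) / δ ^ (p + 1) + 2 := by rw [hA]; ring

/-- **King's per-slice shape (3.63) ⇒ the power-law profile.**  If slice kernels obey
`|g j x y| ≤ C·exp(−δ·ρ(x,y)/(ηL^j))/(ηL^j)^p` for all `j < k` (King's (3.63): `p = d − 2` for the kernel, `p = d − 1`
for its lattice gradient, `δ = δ₀`, `ρ = |x − y|`, slices `s_j = L^jη`), then the telescoped kernel `Σ_{j<k} g j` has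
the profile `C·K/ρ(x,y)^p` at all separations `ρ(x,y) ≥ η`, with `K = 2·(p+1)!/δ^{p+1} + 2` independent of `k` and `η`.
Nothing here is specific to King's operators: `g`, `ρ` are arbitrary. [folklore] -/
theorem abs_sum_slices_le {X : Type*} (g : ℕ → X → X → ℝ) (ρ : X → X → ℝ) (L η δ C : ℝ) (p k : ℕ)
    (hL : 2 ≤ L) (hη : 0 < η) (hδ : 0 < δ) (hC : 0 ≤ C) (hp : 1 ≤ p)
    (hg : ∀ j < k, ∀ x y, |g j x y| ≤ C * (Real.exp (-(δ * (ρ x y / (η * L ^ j)))) / (η * L ^ j) ^ p))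
    (x y : X) (hxy : η ≤ ρ x y) :
    |∑ j ∈ Finset.range k, g j x y| ≤ C * ((2 * (p + 1).factorial / δ ^ (p + 1) + 2) / ρ x y ^ p) := by
  calc |∑ j ∈ Finset.range k, g j x y| ≤ ∑ j ∈ Finset.range k, |g j x y| := Finset.abs_sum_le_sum_abs _ _
    _ ≤ ∑ j ∈ Finset.range k, C * (Real.exp (-(δ * (ρ x y / (η * L ^ j)))) / (η * L ^ j) ^ p) :=
        Finset.sum_le_sum fun j hj => hg j (Finset.mem_range.1 hj) x y
    _ = C * ∑ j ∈ Finset.range k, Real.exp (-(δ * (ρ x y / (η * L ^ j)))) / (η * L ^ j) ^ p := by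
        rw [Finset.mul_sum]
    _ ≤ C * ((2 * (p + 1).factorial / δ ^ (p + 1) + 2) / ρ x y ^ p) := by
        gcongr
        exact sliceSum_le L η δ (ρ x y) p k hL hη hδ hxy hp

/-- The gradient clause of (3.63) in dimension `d ≥ 2` uses `p = d − 1 ≥ 1`; the profile exponent is then `1 − d`:
`ρ^{-(d-1)}`.  (Bookkeeping remark; the kernel clause `p = d − 2` needs `d ≥ 3` — in `d = 2` the kernel slices sum to a
logarithm, as they should.) [folklore] -/
theorem gradient_exponent_ok {d : ℕ} (hd : 2 ≤ d) : 1 ≤ d - 1 := by omega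

end Literature.MathematicalPhysics.QuantumFieldTheory.King1986

end
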